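import Literature.NumberTheory.Sieve.LinnikLeastPrimeAP
import HarnessLib

/-!
# Linnik's theorem, quantitative form: `θ(x; q, a) ≫_ε x/(φ(q) q^ε)` for `x ≥ C₀ q^L`

Topic `Literature/NumberTheory/Sieve`. THEOREMS only (no definition, no named fact, no `sorry`).
Companion of `LinnikLeastPrimeAP.lean` (Linnik's theorem `linnik_leastPrimeAP`: a prime `p ≡ a (mod q)`
below `C q^L`).  Running the same argument with Siegel's theorem at exponent `ε`
(`Siegel.exists_one_sub_realZero_ge`: `1 − β̃ ≥ C(ε) r̃^{−ε}`, ineffective) and with the range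
`P^A ≤ N`, `log N ≤ (log P)²` of Gallagher's Lemma 4.3 gives the quantitative lower bound of the
Linnik–Siegel type (Iwaniec–Kowalski §18.4; Bombieri, *Le grand crible*, p. 55): for every `ε > 0`
there are `L, C₀, c > 0` with
`∑_{p ≤ x, p ≡ a (q)} log p ≥ c x/(φ(q) q^ε)` for all `q ≥ 1`, `(a, q) = 1`, `x ≥ C₀ q^L`.
(In the non-exceptional case the bound is `x/(32 φ(q))`; the loss `q^{−ε}` is the exceptional zero: the
correction `χ̃(a) ∑_{n≤N} n^{β̃−1}` occurs only if the character mod `q` induced by `χ̃` exists, i.e.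
`r̃ ∣ q`, and then `1 − β̃ ≫_ε r̃^{−ε} ≥ q^{−ε}`; the case `1 − β̃ ≥ c/log P` of Landau–Page is harmless
once `A ≥ 1/c`.)

* `Linnik.totient_mul_theta_ge_of_lemma43` — the window form (`P ≥ max(q, P₀)`, `P^A ≤ N`,
  `log N ≤ (log P)²`: `φ(q) θ(N; q, a) ≥ c N/q^ε`), from `lemma43_gallagher`;
* `Literature.NumberTheory.Sieve.linnik_theta_lowerBound` — the theorem, unconditional.

## References

* [Linnik1944] Yu. V. Linnik, Mat. Sb. 15 (57) (1944), 139–178; 347–368.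
* [IwaniecKowalski2004] H. Iwaniec, E. Kowalski, *Analytic Number Theory*, §18.4.
* [Bombieri1987GrandCrible] E. Bombieri, Astérisque 18 (1987), §6, p. 55.
-/

noncomputable section

open Finset Real

namespace Literature.NumberTheory.Sieve

namespace Linnik

open MontgomeryVaughan1975 PrimesInAPGallagher Literature.NumberTheory.LFunctions

set_option maxHeartbeats 800000 in
open scoped Classical in
/-- **`φ(q) θ(N; q, a) ≥ c(ε) N / q^ε` for `P ≥ max(q, P₀(ε))`, `P^A ≤ N`, `log N ≤ (log P)²`**, from
`lemma43_gallagher` and Siegel's theorem at exponent `ε` (`0 < ε ≤ 1`). [cite: Linnik1944]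
[cite: IwaniecKowalski2004, §18.4] -/
theorem totient_mul_theta_ge_of_lemma43 (h43 : lemma43_gallagher) {ε : ℝ} (hε : 0 < ε) (hε1 : ε ≤ 1) :
    ∃ A : ℝ, 1 ≤ A ∧ ∃ P₀ : ℝ, Real.exp (A + 1) ≤ P₀ ∧ ∃ c : ℝ, 0 < c ∧
      ∀ (q : ℕ) [NeZero q] (a : ZMod q), IsUnit a →
      ∀ P : ℝ, P₀ ≤ P → (q : ℝ) ≤ P → ∀ N : ℕ, P ^ A ≤ (N : ℝ) → Real.log N ≤ Real.log P ^ 2 →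
        c * N / (q : ℝ) ^ ε ≤ (q.totient : ℝ) *
          ∑ p ∈ ((Ioc 0 N).filter Nat.Prime).filter (fun p : ℕ => (p : ZMod q) = a), Real.log p := by
  obtain ⟨c₁, hc₁, c₃, hc₃, c₄, hc₄, K, hK, hGal⟩ := sum_norm_gallagherTerm_le_or h43
  obtain ⟨cU, hcU, hU⟩ := exists_exceptionalZero_unique
  obtain ⟨C_S, hC_S, hSiegel⟩ := Siegel.exists_one_sub_realZero_ge (ε := ε) hε
  -- constants
  set c₁' : ℝ := max c₁ 1 with hc₁'
  have hc₁'1 : 1 ≤ c₁' := le_max_right _ _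
  have hc₁c₁' : c₁ ≤ c₁' := le_max_left _ _
  have hK0 : 0 < K := by linarith
  set A : ℝ := max (max 4 (1 / c₄)) (max (Real.log (32 * K * c₁') / c₃ + 1) (1 / cU + 1)) with hA
  have hA4 : 4 ≤ A := (le_max_left _ _).trans' (le_max_left _ _)
  have hAc₄ : 1 / c₄ ≤ A := (le_max_left _ _).trans' (le_max_right _ _)
  have hAK : Real.log (32 * K * c₁') / c₃ ≤ A := by
    have := (le_max_right (max 4 (1 / c₄)) _).trans' (le_max_left (Real.log (32 * K * c₁') / c₃ + 1)
      (1 / cU + 1))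
    linarith
  have hAU : 1 / cU + 1 ≤ A := (le_max_right _ _).trans' (le_max_right _ _)
  have hA1 : 1 ≤ A := by linarith
  set P₀ : ℝ := max (max (Real.exp (A + 1)) (Real.exp (4 * c₁' + 16)))
    (64 / (C_S * Real.log 2) + 16) with hP₀
  have hP₀exp : Real.exp (A + 1) ≤ P₀ := (le_max_left _ _).trans' (le_max_left _ _)
  have hP₀c : Real.exp (4 * c₁' + 16) ≤ P₀ := (le_max_left _ _).trans' (le_max_right _ _)
  have hP₀C : 64 / (C_S * Real.log 2) + 16 ≤ P₀ := le_max_right _ _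
  have hP₀16 : 16 ≤ P₀ := by
    have : 0 ≤ 64 / (C_S * Real.log 2) := by positivity
    linarith
  have hP₀1 : 1 ≤ P₀ := by linarith
  refine ⟨A, hA1, P₀, hP₀exp, min (1 / 16) (C_S * Real.log 2 / 8), by positivity,
    fun q _ a ha P hP hqP N hN1 hlogN2 => ?_⟩
  -- sizes
  have hP16 : 16 ≤ P := hP₀16.trans hP
  have hP1 : 1 < P := by linarith
  have hP0 : 0 < P := by linarith
  have hlogP : 0 < Real.log P := Real.log_pos hP1
  have hlog2 : 0 < Real.log 2 := Real.log_pos (by norm_num)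
  have hlogP2 : Real.log 2 ≤ Real.log P := Real.log_le_log (by norm_num) (by linarith)
  have hlogPA : A + 1 ≤ Real.log P := by
    rw [← Real.log_exp (A + 1)]; exact Real.log_le_log (Real.exp_pos _) (hP₀exp.trans hP)
  have hlogPc : 4 * c₁' + 16 ≤ Real.log P := by
    rw [← Real.log_exp (4 * c₁' + 16)]; exact Real.log_le_log (Real.exp_pos _) (hP₀c.trans hP)
  have hPA1 : 1 ≤ P ^ A := Real.one_le_rpow hP1.le (by linarith)
  have hN1' : (1 : ℝ) ≤ N := hPA1.trans hN1
  have hN0 : (0 : ℝ) < N := by linarith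
  have hNnat : 1 ≤ N := by exact_mod_cast hN1'
  have hlogN : A * Real.log P ≤ Real.log N := by
    rw [← Real.log_rpow hP0]; exact Real.log_le_log (by positivity) hN1
  have hlogN16 : 16 ≤ Real.log N := by
    have := mul_le_mul_of_nonneg_right hA1 hlogP.le
    linarith
  have hN1lt : (1 : ℝ) < N := by
    by_contra h
    have : Real.log N ≤ 0 := Real.log_nonpos hN0.le (not_lt.mp h)
    linarith
  have hq1 : (1 : ℝ) ≤ q := by exact_mod_cast Nat.pos_of_neZero q
  have hq0 : (0 : ℝ) < q := by linarith
  have hqε0 : 0 < (q : ℝ) ^ ε := Real.rpow_pos_of_pos hq0 _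
  have hqε1 : 1 ≤ (q : ℝ) ^ ε := Real.one_le_rpow hq1 hε.le
  have hqεP : (q : ℝ) ^ ε ≤ P := by
    have h1 : (q : ℝ) ^ ε ≤ (q : ℝ) ^ (1 : ℝ) := Real.rpow_le_rpow_of_exponent_le hq1 hε1
    rw [Real.rpow_one] at h1
    exact h1.trans hqP
  -- the range of Lemma 4.3
  have hrange1 : Real.exp (Real.sqrt (Real.log N)) ≤ P := by
    rw [← Real.exp_log hP0, Real.exp_le_exp]
    exact Real.sqrt_le_iff.mpr ⟨hlogP.le, hlogN2⟩
  have hrange2 : P ≤ (N : ℝ) ^ c₄ := by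
    have h1 : P ≤ (P ^ A) ^ c₄ := by
      rw [← Real.rpow_mul hP0.le]
      have : 1 ≤ A * c₄ := by
        rw [div_le_iff₀ hc₄] at hAc₄; linarith
      calc P = P ^ (1 : ℝ) := (Real.rpow_one P).symm
        _ ≤ P ^ (A * c₄) := Real.rpow_le_rpow_of_exponent_le hP1.le this
    exact h1.trans (Real.rpow_le_rpow (by positivity) hN1 hc₄.le)
  -- `E ≤ e^{−c₃ A} ≤ 1/(32 K c₁')`
  set E : ℝ := Real.exp (-c₃ * Real.log N / Real.log P) with hE
  have hE0 : 0 < E := Real.exp_pos _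
  have hEK : E * (32 * K * c₁') ≤ 1 := by
    have h1 : E ≤ Real.exp (-c₃ * A) := by
      rw [hE, Real.exp_le_exp]
      have : c₃ * A ≤ c₃ * Real.log N / Real.log P := by
        rw [le_div_iff₀ hlogP]
        have := mul_le_mul_of_nonneg_left hlogN hc₃.le
        linarith
      have e : -c₃ * Real.log N / Real.log P = -(c₃ * Real.log N / Real.log P) := by ring
      linarith
    have h2 : Real.exp (-c₃ * A) * (32 * K * c₁') ≤ 1 := by
      have h3 : Real.log (32 * K * c₁') ≤ c₃ * A := by rw [div_le_iff₀ hc₃] at hAK; linarith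
      have h4 : 32 * K * c₁' ≤ Real.exp (c₃ * A) := by
        calc 32 * K * c₁' = Real.exp (Real.log (32 * K * c₁')) := (Real.exp_log (by positivity)).symm
          _ ≤ Real.exp (c₃ * A) := Real.exp_le_exp.mpr h3
      have h5 : Real.exp (-c₃ * A) * Real.exp (c₃ * A) = 1 := by
        rw [← Real.exp_add]; simp
      calc Real.exp (-c₃ * A) * (32 * K * c₁') ≤ Real.exp (-c₃ * A) * Real.exp (c₃ * A) :=
            mul_le_mul_of_nonneg_left h4 (Real.exp_pos _).le
        _ = 1 := h5
    exact (mul_le_mul_of_nonneg_right h1 (by positivity)).trans h2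
  -- `φ(q) log q ≤ P²` and `16 P² ≤ N`
  have hφ : (q.totient : ℝ) * Real.log q ≤ P ^ 2 := by
    have h1 : (q.totient : ℝ) ≤ q := by exact_mod_cast Nat.totient_le q
    have h2 : Real.log q ≤ q := (Real.log_le_sub_one_of_pos (by linarith)).trans (by linarith)
    have h3 : Real.log q ≥ 0 := Real.log_nonneg hq1
    calc (q.totient : ℝ) * Real.log q ≤ q * q := mul_le_mul h1 h2 h3 (by linarith)
      _ ≤ P * P := mul_le_mul hqP hqP (by linarith) hP0.le
      _ = P ^ 2 := by ring
  have hP2N : 16 * P ^ 2 ≤ N := by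
    have h1 : 16 * P ^ 2 ≤ P ^ (3 : ℝ) := by
      rw [show (3 : ℝ) = (3 : ℕ) by norm_num, Real.rpow_natCast]
      have := mul_le_mul_of_nonneg_right hP16 (sq_nonneg P)
      calc 16 * P ^ 2 ≤ P * P ^ 2 := this
        _ = P ^ 3 := by ring
    have h2 : P ^ (3 : ℝ) ≤ P ^ A := Real.rpow_le_rpow_of_exponent_le hP1.le (by linarith)
    linarith
  have hP2 : (256 : ℝ) ≤ P ^ 2 := by
    have := mul_le_mul hP16 hP16 (by norm_num) (by linarith)
    calc (256 : ℝ) = 16 * 16 := by norm_num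
      _ ≤ P * P := this
      _ = P ^ 2 := by ring
  -- the size of the claimed lower bound
  have hcN : min (1 / 16) (C_S * Real.log 2 / 8) * N / (q : ℝ) ^ ε ≤ (N : ℝ) / 16 := by
    rw [div_le_iff₀ hqε0]
    have h1 : min (1 / 16) (C_S * Real.log 2 / 8) * (N : ℝ) ≤ 1 / 16 * N :=
      mul_le_mul_of_nonneg_right (min_le_left _ _) hN0.le
    have h2 : 1 / 16 * (N : ℝ) ≤ N / 16 * (q : ℝ) ^ ε := by
      have := mul_le_mul_of_nonneg_left hqε1 (show 0 ≤ (N : ℝ) / 16 by positivity)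
      linarith
    linarith
  have hcN' : min (1 / 16) (C_S * Real.log 2 / 8) * N / (q : ℝ) ^ ε ≤
      C_S * Real.log 2 / 8 * N / (q : ℝ) ^ ε :=
    div_le_div_of_nonneg_right (mul_le_mul_of_nonneg_right (min_le_right _ _) hN0.le) hqε0.le
  rcases hGal N P hNnat hrange1 hrange2 hP1.le q hqP with ⟨-, hAsum⟩ | ⟨r, hr, χe, β, hexc, hBsum⟩
  · -- no exceptional zero
    have hθ := totient_mul_theta_ge_exc ha N (r := 0) (1 : DirichletCharacter ℂ 0) 1
    rw [sum_inducedBy_zero_eq_zero a (1 : DirichletCharacter ℂ 0), Complex.zero_re, zero_mul,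
      sub_zero] at hθ
    simp only [gallagherTermExc_zero_eq] at hθ
    have h1 : ∑ χ : DirichletCharacter ℂ q, ‖gallagherTerm χ.primitiveCharacter N N‖ ≤ N / 16 := by
      refine hAsum.trans ?_
      have : 2 * (N : ℝ) * K * E = (N / 16) * (E * (32 * K * 1)) := by ring
      rw [this]
      have hE1 : E * (32 * K * 1) ≤ 1 :=
        le_trans (mul_le_mul_of_nonneg_left (by nlinarith) hE0.le) hEK
      exact mul_le_of_le_one_right (by positivity) hE1
    exact hcN.trans (by linarith only [hθ, h1, hφ, hP2N, hP2, hN0])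
  · -- the exceptional zero `β` of `χ̃` mod `r` occurs
    haveI := hr
    obtain ⟨hprim, hne1, hrP, hβlow, hβ1, hLβ⟩ := hexc
    have hθ := totient_mul_theta_ge_exc ha N χe β
    have hr' := abs_re_sum_inducedBy_le_one a χe
    -- `3/4 ≤ β < 1`, `0 < 1 − β`
    have hβ34 : 3 / 4 ≤ β := by
      have h1 : c₁ / Real.log P ≤ 1 / 4 := by
        rw [div_le_iff₀ hlogP]; linarith
      linarith
    have hβ0 : 0 < β := by linarith
    have hδ0 : 0 < 1 - β := by linarith
    have hδc₁ : (1 - β) * Real.log P ≤ c₁' := by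
      have h1 : 1 - β ≤ c₁ / Real.log P := by linarith
      calc (1 - β) * Real.log P ≤ c₁ / Real.log P * Real.log P :=
            mul_le_mul_of_nonneg_right h1 hlogP.le
        _ = c₁ := div_mul_cancel₀ c₁ hlogP.ne'
        _ ≤ c₁' := hc₁c₁'
    -- the error from Lemma 4.3: `≤ N/16`
    have hc₁'0 : c₁' ≠ 0 := by positivity
    have herr : ∑ χ : DirichletCharacter ℂ q, ‖gallagherTermExc χe β χ.primitiveCharacter N N‖ ≤
        N / 16 * ((1 - β) * Real.log P) / c₁' := by
      refine hBsum.trans ?_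
      have e : 2 * (N : ℝ) * K * ((1 - β) * Real.log P) * E =
          N / 16 * ((1 - β) * Real.log P) / c₁' * (E * (32 * K * c₁')) := by
        field_simp; ring
      rw [e]
      exact mul_le_of_le_one_right (by positivity) hEK
    have herr' : ∑ χ : DirichletCharacter ℂ q, ‖gallagherTermExc χe β χ.primitiveCharacter N N‖ ≤
        N / 16 := by
      refine herr.trans ?_
      rw [div_le_iff₀ (by positivity)]
      exact mul_le_mul_of_nonneg_left hδc₁ (by positivity)
    -- is some character mod `q` induced by `χ̃`?
    by_cases hind : ((univ : Finset (DirichletCharacter ℂ q)).filter (fun χ =>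
        χ.conductor = r ∧ ∀ n : ℕ, χ.primitiveCharacter (n : ZMod χ.conductor) = χe (n : ZMod r))).Nonempty
    swap
    · -- no: the correction is absent, `φ θ ≥ N − N/16 − P²`
      rw [Finset.not_nonempty_iff_eq_empty] at hind
      rw [hind, Finset.sum_empty, Complex.zero_re, zero_mul, sub_zero] at hθ
      exact hcN.trans (by linarith only [hθ, herr', hφ, hP2N, hP2, hN0])
    -- yes: then `r ∣ q`, so `r ≤ q`
    obtain ⟨χ₀, hχ₀⟩ := hind
    rw [Finset.mem_filter] at hχ₀
    have hrq : (r : ℝ) ≤ q := by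
      have h1 : r ∣ q := hχ₀.2.1 ▸ χ₀.conductor_dvd_level
      exact_mod_cast Nat.le_of_dvd (Nat.pos_of_neZero q) h1
    have hr0 : (0 : ℝ) < r := by exact_mod_cast Nat.pos_of_neZero r
    obtain ⟨r', hr'def⟩ : ∃ r' : ℝ, r' = (∑ χ ∈ (univ : Finset (DirichletCharacter ℂ q)).filter
        (fun χ => χ.conductor = r ∧
          ∀ n : ℕ, χ.primitiveCharacter (n : ZMod χ.conductor) = χe (n : ZMod r)), χ a⁻¹).re :=
      ⟨_, rfl⟩
    obtain ⟨Sβ, hSβ⟩ : ∃ S : ℝ, S = ∑ n ∈ Ioc 0 N, (n : ℝ) ^ (β - 1) := ⟨_, rfl⟩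
    rw [← hr'def, ← hSβ] at hθ
    rw [← hr'def] at hr'
    -- the main term
    have hS : |Sβ - (N : ℝ) ^ β / β| ≤ 1 / β := hSβ ▸ abs_sum_rpow_sub_div_le hNnat hβ0 hβ1.le
    have hmainβ := sub_mul_rpow_div_ge (r := r') hN1lt (by linarith) hβ34 hβ1 hr'
    have h43 : 1 / β ≤ 4 / 3 := by rw [div_le_div_iff₀ hβ0 (by norm_num)]; linarith
    have hmain : (N : ℝ) / 4 * min 1 ((1 - β) * Real.log N) - 4 / 3 ≤ N - r' * Sβ := by
      have h1 : |r' * (Sβ - (N : ℝ) ^ β / β)| ≤ 4 / 3 := by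
        rw [abs_mul]
        calc |r'| * |Sβ - (N : ℝ) ^ β / β| ≤ 1 * (1 / β) := mul_le_mul hr' hS (abs_nonneg _) zero_le_one
          _ ≤ 4 / 3 := by linarith
      have h2 := (abs_le.mp h1).2
      have e : (N : ℝ) - r' * Sβ = (N - r' * (N : ℝ) ^ β / β) - r' * (Sβ - (N : ℝ) ^ β / β) := by ring
      rw [e]; linarith only [hmainβ, h2]
    rcases le_or_gt 1 ((1 - β) * Real.log N) with hB1 | hB2
    · -- `(1 − β) log N ≥ 1`: main term `≥ N/4`
      rw [min_eq_left hB1, mul_one] at hmain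
      exact hcN.trans (by linarith only [hθ, hmain, herr', hφ, hP2N, hP2])
    · -- `(1 − β) log N < 1`: then `χ̃` is quadratic (Landau–Page at `T = P`, since otherwise
      -- `(1 − β) log N ≥ c_U log N/log P ≥ c_U A ≥ 1`), and Siegel gives `1 − β ≥ C_S r^{−ε} ≥ C_S q^{−ε}`
      rw [min_eq_right hB2.le] at hmain
      have hβU : 1 - cU / Real.log P < β := by
        by_contra hcon
        push Not at hcon
        have h1 : cU / Real.log P ≤ 1 - β := by linarith
        have h2 : cU / Real.log P * Real.log N ≤ (1 - β) * Real.log N :=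
          mul_le_mul_of_nonneg_right h1 (by linarith)
        have h3 : cU * A ≤ cU / Real.log P * Real.log N := by
          rw [div_mul_eq_mul_div, le_div_iff₀ hlogP]
          have := mul_le_mul_of_nonneg_left hlogN hcU.le
          linarith
        have h4 : 1 ≤ cU * A := by
          have := mul_le_mul_of_nonneg_left hAU hcU.le
          have e : cU * (1 / cU + 1) = 1 + cU := by field_simp
          linarith
        linarith
      have hsq : χe ^ 2 = 1 :=
        ((hU P (by linarith)).1 r χe hne1 hrP (β : ℂ) hLβ
          (by rw [Complex.ofReal_im, abs_zero]; linarith) (by rw [Complex.ofReal_re]; exact hβU)).1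
      have hSg := hSiegel r χe hsq hne1 β hLβ
      have hδlow : C_S / (q : ℝ) ^ ε ≤ 1 - β := by
        have hrq' : (r : ℝ) ^ (-ε) ≥ (q : ℝ) ^ (-ε) := Real.rpow_le_rpow_of_nonpos hr0 hrq (by linarith)
        calc C_S / (q : ℝ) ^ ε = C_S * (q : ℝ) ^ (-ε) := by rw [Real.rpow_neg hq0.le, div_eq_mul_inv]
          _ ≤ C_S * (r : ℝ) ^ (-ε) := mul_le_mul_of_nonneg_left hrq' hC_S.le
          _ ≤ 1 - β := hSg
      set X : ℝ := (1 - β) * Real.log P with hX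
      have hX0 : 0 < X := mul_pos hδ0 hlogP
      have hmain' : (N : ℝ) / 4 * (A * X) - 4 / 3 ≤ N - r' * Sβ := by
        have : (N : ℝ) / 4 * (A * X) ≤ N / 4 * ((1 - β) * Real.log N) := by
          refine mul_le_mul_of_nonneg_left ?_ (by positivity)
          rw [hX]
          have := mul_le_mul_of_nonneg_left hlogN hδ0.le
          linarith only [this]
        linarith only [this, hmain]
      have herr'' : ∑ χ : DirichletCharacter ℂ q, ‖gallagherTermExc χe β χ.primitiveCharacter N N‖ ≤
          N / 16 * (A * X) := by
        refine herr.trans ?_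
        have h1 : (N : ℝ) / 16 * X / c₁' ≤ N / 16 * X := div_le_self (by positivity) hc₁'1
        have h2 : (N : ℝ) / 16 * X ≤ N / 16 * (A * X) :=
          mul_le_mul_of_nonneg_left (le_mul_of_one_le_left hX0.le hA1) (by positivity)
        exact h1.trans h2
      -- `X ≥ C_S log 2 / q^ε ≥ C_S log 2 / P`
      have hXε : C_S * Real.log 2 / (q : ℝ) ^ ε ≤ X := by
        rw [hX]
        calc C_S * Real.log 2 / (q : ℝ) ^ ε = C_S / (q : ℝ) ^ ε * Real.log 2 := by ring
          _ ≤ (1 - β) * Real.log P := mul_le_mul hδlow hlogP2 hlog2.le hδ0.le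
      have hX1 : C_S * Real.log 2 / P ≤ X :=
        (div_le_div_of_nonneg_left (mul_nonneg hC_S.le hlog2.le) hqε0 hqεP).trans hXε
      -- `P² + 4/3 ≤ (N/16) A X` from `X ≥ C_S log 2/P`, `N ≥ P^A ≥ P⁴`, `P ≥ 64/(C_S log 2)`
      have hkey : P ^ 2 + 4 / 3 ≤ (N : ℝ) / 16 * (A * X) := by
        have hN4 : P ^ 4 ≤ (N : ℝ) := by
          have : P ^ (4 : ℝ) ≤ P ^ A := Real.rpow_le_rpow_of_exponent_le hP1.le hA4
          rw [show (4 : ℝ) = (4 : ℕ) by norm_num, Real.rpow_natCast] at this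
          exact this.trans hN1
        have hPC : 64 / (C_S * Real.log 2) ≤ P := by linarith
        have hPC' : 64 ≤ P * (C_S * Real.log 2) := by
          rwa [div_le_iff₀ (by positivity)] at hPC
        have hc0 : 0 ≤ C_S * Real.log 2 / P := div_nonneg (mul_nonneg hC_S.le hlog2.le) hP0.le
        have hX2 : C_S * Real.log 2 / P ≤ A * X := hX1.trans (le_mul_of_one_le_left hX0.le hA1)
        have h1 : P ^ 4 * (C_S * Real.log 2 / P) ≤ (N : ℝ) * (A * X) := mul_le_mul hN4 hX2 hc0 hN0.le
        have h2 : P ^ 4 * (C_S * Real.log 2 / P) = P ^ 2 * (P * (C_S * Real.log 2)) := by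
          field_simp
        rw [h2] at h1
        have h3 : P ^ 2 * 64 ≤ P ^ 2 * (P * (C_S * Real.log 2)) :=
          mul_le_mul_of_nonneg_left hPC' (sq_nonneg P)
        linarith only [h1, h3, hP2]
      -- conclusion: `φ θ ≥ N A X/8 ≥ (C_S log 2/8) N/q^ε`
      have hXε' : C_S * Real.log 2 / (q : ℝ) ^ ε ≤ A * X := hXε.trans (le_mul_of_one_le_left hX0.le hA1)
      have h5 : (N : ℝ) * (C_S * Real.log 2 / (q : ℝ) ^ ε) ≤ N * (A * X) :=
        mul_le_mul_of_nonneg_left hXε' hN0.le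
      have e5 : C_S * Real.log 2 / 8 * (N : ℝ) / (q : ℝ) ^ ε = N * (C_S * Real.log 2 / (q : ℝ) ^ ε) / 8 := by
        field_simp
      refine hcN'.trans ?_
      rw [e5]
      linarith only [hθ, hmain', herr'', hφ, hkey, hP2, h5]

end Linnik

open MontgomeryVaughan1975 in
/-- **LINNIK'S THEOREM, QUANTITATIVE FORM** (Linnik–Siegel lower bound), unconditional: for every
`ε > 0` there are `L, C₀, c > 0` such that for all `q ≥ 1`, all `a` coprime to `q` and all real
`x ≥ C₀ q^L`, `∑_{p ≤ x prime, p ≡ a (mod q)} log p ≥ c · x/(φ(q) q^ε)`.  (`N = ⌊x⌋`, and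
`P = max(q, P₀)` if `log x ≤ (log P)²`, else `P = exp(√(log x))`; `Linnik.totient_mul_theta_ge_of_lemma43`
with `lemma43_gallagher_holds`.) [cite: Linnik1944] [cite: IwaniecKowalski2004, §18.4] -/
theorem linnik_theta_lowerBound {ε : ℝ} (hε : 0 < ε) :
    ∃ L C₀ c : ℝ, 0 < L ∧ 0 < C₀ ∧ 0 < c ∧ ∀ q : ℕ, 1 ≤ q → ∀ a : ℕ, a.Coprime q →
      ∀ x : ℝ, C₀ * (q : ℝ) ^ L ≤ x →
        c * x / (q.totient * (q : ℝ) ^ ε) ≤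
          ∑ p ∈ ((Ioc 0 ⌊x⌋₊).filter Nat.Prime).filter (fun p : ℕ => p ≡ a [MOD q]), Real.log p := by
  classical
  -- reduce to `ε' = min ε 1`
  set ε' : ℝ := min ε 1 with hε'
  have hε'0 : 0 < ε' := lt_min hε one_pos
  have hε'1 : ε' ≤ 1 := min_le_right _ _
  have hε'ε : ε' ≤ ε := min_le_left _ _
  obtain ⟨A, hA1, P₀, hP₀exp, c, hc, h⟩ :=
    Linnik.totient_mul_theta_ge_of_lemma43 lemma43_gallagher_holds hε'0 hε'1
  have hP₀1 : 1 ≤ P₀ := le_trans (by have := Real.add_one_le_exp (A + 1); linarith) hP₀exp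
  have hP₀0 : 0 < P₀ := by linarith
  refine ⟨A, 2 * P₀ ^ A, c / 2, by linarith, by positivity, by positivity, fun q hq a haq x hx => ?_⟩
  haveI : NeZero q := ⟨by omega⟩
  have hq1 : (1 : ℝ) ≤ q := by exact_mod_cast hq
  have hq0 : (0 : ℝ) < q := by linarith
  have hP₀A : 1 ≤ P₀ ^ A := Real.one_le_rpow hP₀1 (by linarith)
  have hqA1 : 1 ≤ (q : ℝ) ^ A := Real.one_le_rpow hq1 (by linarith)
  have hx2 : 2 * (P₀ ^ A * (q : ℝ) ^ A) ≤ x := by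
    have : 2 * P₀ ^ A * (q : ℝ) ^ A = 2 * (P₀ ^ A * (q : ℝ) ^ A) := by ring
    linarith
  have hPq2 : (2 : ℝ) ≤ x := by
    have : (1 : ℝ) ≤ P₀ ^ A * (q : ℝ) ^ A := one_le_mul_of_one_le_of_one_le hP₀A hqA1
    linarith
  have hx0 : 0 < x := by linarith
  -- `N = ⌊x⌋ ≥ x/2`
  set N : ℕ := ⌊x⌋₊ with hN
  have hNx : (N : ℝ) ≤ x := Nat.floor_le hx0.le
  have hxN : x - 1 < N := by have := Nat.lt_floor_add_one x; linarith
  have hNx2 : x / 2 ≤ N := by linarith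
  have hN0 : (0 : ℝ) < N := by linarith
  have hlogNx : Real.log N ≤ Real.log x := Real.log_le_log hN0 hNx
  have ha : IsUnit (a : ZMod q) := (ZMod.isUnit_iff_coprime a q).mpr haq
  -- `P₁ = max(q, P₀)` and `P₁^A ≤ x/2`
  set P₁ : ℝ := max (q : ℝ) P₀ with hP₁
  have hP₁0 : 0 < P₁ := lt_of_lt_of_le hq0 (le_max_left _ _)
  have hP₁A : P₁ ^ A ≤ x / 2 := by
    have hle : P₁ ≤ (q : ℝ) * P₀ := by
      rcases le_total (q : ℝ) P₀ with hle | hle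
      · rw [hP₁, max_eq_right hle]; exact le_mul_of_one_le_left (by linarith) hq1
      · rw [hP₁, max_eq_left hle]; exact le_mul_of_one_le_right (by linarith) hP₀1
    calc P₁ ^ A ≤ ((q : ℝ) * P₀) ^ A := Real.rpow_le_rpow hP₁0.le hle (by linarith)
      _ = P₀ ^ A * (q : ℝ) ^ A := by rw [Real.mul_rpow hq0.le (by linarith)]; ring
      _ ≤ x / 2 := by linarith
  -- the common conclusion from the window theorem at a suitable `P`
  have key : ∀ P : ℝ, P₀ ≤ P → (q : ℝ) ≤ P → P ^ A ≤ (N : ℝ) → Real.log N ≤ Real.log P ^ 2 →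
      c / 2 * x / (q.totient * (q : ℝ) ^ ε) ≤
        ∑ p ∈ ((Ioc 0 N).filter Nat.Prime).filter (fun p : ℕ => p ≡ a [MOD q]), Real.log p := by
    intro P hP hqP hPN hlogN
    have hmain := h q (a : ZMod q) ha P hP hqP N hPN hlogN
    have hsum : ∑ p ∈ ((Ioc 0 N).filter Nat.Prime).filter (fun p : ℕ => (p : ZMod q) = (a : ZMod q)),
        Real.log p = ∑ p ∈ ((Ioc 0 N).filter Nat.Prime).filter (fun p : ℕ => p ≡ a [MOD q]),
          Real.log p := by
      refine Finset.sum_congr ?_ fun _ _ => rfl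
      ext p
      simp only [Finset.mem_filter, ZMod.natCast_eq_natCast_iff]
    rw [hsum] at hmain
    have hφ0 : (0 : ℝ) < q.totient := by exact_mod_cast Nat.totient_pos.mpr (Nat.pos_of_neZero q)
    have hqε : (q : ℝ) ^ ε' ≤ (q : ℝ) ^ ε := Real.rpow_le_rpow_of_exponent_le hq1 hε'ε
    have hqε0 : 0 < (q : ℝ) ^ ε' := Real.rpow_pos_of_pos hq0 _
    -- `c/2 · x/(φ q^ε) ≤ c N/(φ q^{ε'})`
    rw [div_le_iff₀ (mul_pos hφ0 (Real.rpow_pos_of_pos hq0 _))]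
    have h1 : c * N / (q : ℝ) ^ ε' * (q : ℝ) ^ ε' ≤
        (∑ p ∈ ((Ioc 0 N).filter Nat.Prime).filter (fun p : ℕ => p ≡ a [MOD q]), Real.log p) *
          q.totient * (q : ℝ) ^ ε' := by
      have := mul_le_mul_of_nonneg_right hmain hqε0.le
      linarith [this]
    rw [div_mul_cancel₀ _ hqε0.ne'] at h1
    have hS0 : 0 ≤ ∑ p ∈ ((Ioc 0 N).filter Nat.Prime).filter (fun p : ℕ => p ≡ a [MOD q]),
        Real.log p := Finset.sum_nonneg fun p hp => by
      have hp' : p.Prime := (Finset.mem_filter.mp (Finset.mem_filter.mp hp).1).2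
      exact Real.log_nonneg (by exact_mod_cast hp'.one_lt.le)
    have h2 : (∑ p ∈ ((Ioc 0 N).filter Nat.Prime).filter (fun p : ℕ => p ≡ a [MOD q]), Real.log p) *
          q.totient * (q : ℝ) ^ ε' ≤
        (∑ p ∈ ((Ioc 0 N).filter Nat.Prime).filter (fun p : ℕ => p ≡ a [MOD q]), Real.log p) *
          (q.totient * (q : ℝ) ^ ε) := by
      rw [mul_assoc]
      exact mul_le_mul_of_nonneg_left (mul_le_mul_of_nonneg_left hqε hφ0.le) hS0
    have h3 : c / 2 * x ≤ c * N := by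
      have := mul_le_mul_of_nonneg_left hNx2 hc.le
      linarith
    linarith
  by_cases hreg : Real.log x ≤ Real.log P₁ ^ 2
  · -- moderate `x`: `P = P₁`
    exact key P₁ (le_max_right _ _) (le_max_left _ _) (by linarith) (hlogNx.trans hreg)
  · -- large `x`: `P = exp(√(log x))`
    push Not at hreg
    have hlogx0 : 0 < Real.log x := Real.log_pos (by linarith)
    set u : ℝ := Real.sqrt (Real.log x) with hu
    have hu2 : u ^ 2 = Real.log x := Real.sq_sqrt hlogx0.le
    have hu0 : 0 ≤ u := Real.sqrt_nonneg _
    have hlogP₁ : Real.log P₁ < u := by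
      rw [hu, ← Real.sqrt_sq (Real.log_nonneg ((le_max_right _ _).trans' hP₀1))]
      exact Real.sqrt_lt_sqrt (sq_nonneg _) hreg
    set P : ℝ := Real.exp u with hP
    have hP0 : 0 < P := Real.exp_pos _
    have hlogP : Real.log P = u := Real.log_exp u
    have hP₁P : P₁ ≤ P := by
      rw [← Real.exp_log hP₁0]; exact Real.exp_le_exp.mpr hlogP₁.le
    -- `P^A ≤ N`: `A u ≤ u² − log 2 ≤ log N`, using `u > log P₁ ≥ log P₀ ≥ A + 1`
    have hA1u : A + 1 ≤ u := by
      have h1 : A + 1 ≤ Real.log P₀ := by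
        rw [← Real.log_exp (A + 1)]; exact Real.log_le_log (Real.exp_pos _) hP₀exp
      have h2 : Real.log P₀ ≤ Real.log P₁ := Real.log_le_log hP₀0 (le_max_right _ _)
      linarith
    have hlog2 : Real.log 2 < 1 := by
      have := Real.log_two_lt_d9; linarith
    have hlogN2 : Real.log x - Real.log 2 ≤ Real.log N := by
      have h1 : Real.log (x / 2) ≤ Real.log N := Real.log_le_log (by linarith) hNx2
      rwa [Real.log_div hx0.ne' (by norm_num)] at h1
    have hPA : P ^ A ≤ (N : ℝ) := by
      rw [hP, ← Real.exp_mul, ← Real.exp_log hN0, Real.exp_le_exp]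
      have h0 := mul_le_mul_of_nonneg_left hA1u hu0
      have h1 : u * A ≤ u ^ 2 - Real.log 2 := by nlinarith
      linarith
    exact key P ((le_max_right _ _).trans hP₁P) ((le_max_left _ _).trans hP₁P) hPA
      (by rw [hlogP, hu2]; exact hlogNx)

open MontgomeryVaughan1975 in
/-- **Linnik's theorem, quantitative count form**: for every `ε > 0` there are `L, C₀, c > 0` with
`#{p ≤ x prime : p ≡ a (mod q)} ≥ c · x/(φ(q) q^ε log x)` for all `q ≥ 1`, `(a, q) = 1`, `x ≥ C₀ q^L`
(each `log p ≤ log x` in `linnik_theta_lowerBound`). [cite: Linnik1944] [cite: IwaniecKowalski2004, §18.4] -/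
theorem linnik_primeCounting_lowerBound {ε : ℝ} (hε : 0 < ε) :
    ∃ L C₀ c : ℝ, 0 < L ∧ 0 < C₀ ∧ 0 < c ∧ ∀ q : ℕ, 1 ≤ q → ∀ a : ℕ, a.Coprime q →
      ∀ x : ℝ, C₀ * (q : ℝ) ^ L ≤ x →
        c * x / (q.totient * (q : ℝ) ^ ε * Real.log x) ≤
          ((((Ioc 0 ⌊x⌋₊).filter Nat.Prime).filter (fun p : ℕ => p ≡ a [MOD q])).card : ℝ) := by
  obtain ⟨L, C₀, c, hL, hC₀, hc, h⟩ := linnik_theta_lowerBound hε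
  -- enlarge `C₀` so that `x ≥ 2`
  refine ⟨L, max C₀ 2, c, hL, lt_max_of_lt_left hC₀, hc, fun q hq a haq x hx => ?_⟩
  have hq1 : (1 : ℝ) ≤ q := by exact_mod_cast hq
  have hqL : 1 ≤ (q : ℝ) ^ L := Real.one_le_rpow hq1 hL.le
  have hxC : C₀ * (q : ℝ) ^ L ≤ x :=
    le_trans (mul_le_mul_of_nonneg_right (le_max_left _ _) (by positivity)) hx
  have hx2 : (2 : ℝ) ≤ x := by
    have h1 : (2 : ℝ) * 1 ≤ max C₀ 2 * (q : ℝ) ^ L := mul_le_mul (le_max_right _ _) hqL zero_le_one (by positivity)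
    linarith
  have hlogx : 0 < Real.log x := Real.log_pos (by linarith)
  have hθ := h q hq a haq x hxC
  set S := ((Ioc 0 ⌊x⌋₊).filter Nat.Prime).filter (fun p : ℕ => p ≡ a [MOD q]) with hS
  have hsum : ∑ p ∈ S, Real.log p ≤ (S.card : ℝ) * Real.log x := by
    have := Finset.sum_le_card_nsmul S (fun p : ℕ => Real.log p) (Real.log x) (fun p hp => ?_)
    · rwa [nsmul_eq_mul] at this
    · have hp' := Finset.mem_filter.mp (Finset.mem_filter.mp hp).1
      have hpx : (p : ℝ) ≤ x := le_trans (by exact_mod_cast (Finset.mem_Ioc.mp hp'.1).2) (Nat.floor_le (by linarith))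
      exact Real.log_le_log (by exact_mod_cast hp'.2.pos) hpx
  have hφ0 : (0 : ℝ) < q.totient := by exact_mod_cast Nat.totient_pos.mpr (by omega)
  have hden : 0 < (q.totient : ℝ) * (q : ℝ) ^ ε := mul_pos hφ0 (Real.rpow_pos_of_pos (by linarith) _)
  rw [div_le_iff₀ (mul_pos hden hlogx)]
  rw [div_le_iff₀ hden] at hθ
  have := mul_le_mul_of_nonneg_right hθ hlogx.le
  nlinarith [hsum, hden]

end Literature.NumberTheory.Sieve

end
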